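import Mathlib
import Literature.MathematicalPhysics.QuantumFieldTheory.Balaban1983to89.T4CubeShellBlocks
import Literature.MathematicalPhysics.QuantumFieldTheory.Balaban1983to89.T4CubeShellTowerMarkov
import Literature.MathematicalPhysics.QuantumFieldTheory.Balaban1983to89.T4CubeShellResponseStein
import Literature.MathematicalPhysics.QuantumFieldTheory.Balaban1983to89.T4CubeShellConditional

/-!
# `Balaban1983to89.T4CubeShellDoubling` — SHELL CONDITIONING OF THE WINDOWED GIBBS LAW ON A CUBE, V: the gradient of the
# conditional mean, differentiation under the windowed integral, and the TWO-SIDED CONDITIONING BOUND for the cube covariance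
# («doubling step»): Markov property + Brascamp–Lieb on the window + the response identity
# (H. J. Brascamp, E. H. Lieb, JFA **22** (1976) = [BrascampLieb1976] Thm 4.1; S. Friedli, Y. Velenik, *Statistical Mechanics of
# Lattice Systems*, CUP 2017 = [FriedliVelenik2017] Exercise 3.11 (3.26), Lemma 3.31, Lemma 6.3, Lemma 6.7, §6.10.1 (6.110);
# J. Glimm, A. Jaffe, *Quantum Physics* 2nd ed. 1987 = [GlimmJaffe1987] §4.3 Cor. 4.3.4; R. Durrett, *Probability* 5th ed. 2019 =
# [Durrett2019] Thm A.5.1–A.5.3; M. Spivak, *Calculus on Manifolds* 1965 = [Spivak1965] Thm 2-2, 2-3, 2-9)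

statement-and-proof file: textbook calculus ∕ probability on the tree's cube model, every public declaration cite-tagged; nothing
here is a claim about the Yang–Mills mass gap

CITATION HEADER (lean-in-tree rule).  Ideation cell `ym-nodeO-ideate` (portfolio track), seat P8 «dual witness for the
β-interval bounds», memo `memos/ROUTE-p8.md` (v7.1 sha256 0b3d2e46…; v7.2 §78 ff. records this edition).  LANDING EDITION
(generation 11), module V of the series «CubeShell I–V», cut from the memo companion `memos/ROUTE-p8-SketchG8.lean` («G8», 979 l.,
57 declarations, 0 `sorry`, 0 `axiom`; farm `lean check` rc 0, `#print axioms` standard): G8 §B :246–:394 (gradient of the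
conditional mean; the step), §D :668–:767 (differentiation under the windowed integral), §E :769–:828 (profile form), §F :896–:977
(Brascamp–Lieb on the fibre; two scales).  Statements and proof terms are CHARACTER-IDENTICAL to G8's; edition deltas = namespace,
this header, the split (module IV = `T4CubeShellConditional` holds G8 §A, §C), per-declaration cite tags (each names the printed
statement the declaration instantiates on the cube model; proofs ours), `private` on the plumbing lemma `shellMean_zero`.  LABELS
(memo-side words, NOT tree declarations): «(D1)»–«(D5)» as in module I's header — «(D1)» Brascamp–Lieb on the window (module I
`abs_cubeCov_le`), «(D2)» the Markov ∕ tower factorisation (module II `cubeCov_markov`), «(D3)» the response identity (module III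
`hasDerivAt_shellMean`); labels `lab : Fin n → Fin 3`: `0` inside, `1` shell, `2` outside, `N = #{j | lab j = 1}`.

HONEST FRAMING.  Nothing here is printed in Bałaban's papers and nothing is asserted about his densities: every declaration is
[folklore] calculus ∕ probability — the cube-window, continuous-spin instance of the cited textbook statements — on the TREE's cube
model `T4CubePoincare` and modules I–IV.  The headline inequality `abs_cubeCov_le_doubling` is the COMPOSITION, on that model, of
three cited statements — (D2) `Cov_K(F,H) = Cov_K(E[F|shell], E[H|shell])` for inside-`F`, outside-`H` ([FriedliVelenik2017]
(3.26)), (D1) Brascamp–Lieb for that covariance ([BrascampLieb1976] Thm 4.1), (D3) `∂_j E[F|x_shell] = E[∂_jF|·] − Cov(F, ∂_j f|·)`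
([GlimmJaffe1987] Cor. 4.3.4, proof) with `E[∂_jF|·] = 0` for inside-`F` and shell-`j` — and reads: `|Cov_K(F,H)| ≤ λ⁻¹ a b`
whenever `a² ≥ Σ_shell sup|Cov(F, ∂_j f₁|·)|²`, `b² ≥ Σ_shell sup|Cov(H, ∂_j f₂|·)|²`.  The composition (a two-sided conditioning
bound whose right side is a product of HALF-DISTANCE conditional covariances — the covariance analogue of the Lieb–Simon
two-point inequality, cf. N. Madras, G. Slade, *The Self-Avoiding Walk* 1993, Lemma A.1) is this series' arrangement; its USE
(a scale recursion for covariance decay of windowed Gibbs laws, memo-side) is NOT in the tree and is not claimed printed.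

WHAT IS PROVED (no `sorry`, no new axiom; `#print axioms` ⊆ {propext, Classical.choice, Quot.sound}).
* §B the gradient of `x ↦ E[F | x_shell]` (module I `shellMean`): `0` off the shell for every `F` (shell-measurability, module IV
  §A), and on a shell coordinate `j` the response value of module III's `hasDerivAt_shellMean`; `gradSq_shellMean_le`:
  `|∇E[F|·](x)|² ≤ Σ_{shell j} β_j²` when `E[∂_jF|·] = 0` and `|Cov(F, ∂_j f₁|·)| ≤ β_j` on the window; **`abs_cubeCov_le_doubling`**
  (binders: `f₁, f₂ ∈ C²`, `HessianBound (f₁ + f₂) λ`, `f₁` outside-blind, `f₂` inside-blind, `F` inside-, `H` outside-measurable,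
  `F, H ∈ C¹`, plus `C¹` of the two conditional means — discharged in §D).
* §D differentiation under the windowed integral in the SHELL PARAMETER ([Durrett2019] Thm A.5.1–A.5.3, Fréchet form, dominated
  by a compactness bound): `hasFDerivAt_setIntegral_merge`, `contDiff_one_setIntegral_merge`, **`contDiff_one_shellMean`**
  (`E[F | x_shell] ∈ C¹` for `f, F ∈ C¹`, `S > 0`), `contDiff_one_shellCov`; `abs_cubeCov_le_doubling'` = the step with structural
  hypotheses only.
* §E the step with `0 ≤ a, b` and in PROFILE form `abs_cubeCov_le_doubling_profile`:
  `|Cov_K(F,H)| ≤ λ⁻¹ · N · (C_F C_H) · (κ₁ κ₂)` from `|Cov(F, ∂_j f₁|·)| ≤ C_F κ₁`, `|Cov(H, ∂_j f₂|·)| ≤ C_H κ₂` (`N = #shell`).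
* §F **`abs_shellCov_le`**: Brascamp–Lieb ON THE FIBRE, `|Cov(F, G | x_shell)| ≤ λ⁻¹ a b` for outside-blind `F, G ∈ C¹` with
  `|∇F| ≤ a`, `|∇G| ≤ b` — module I's `abs_cubeCov_le` applied to module IV's `condPot` (`shellCov_eq_cubeCov_condPot`,
  `hessianBound_condPot`); **`abs_cubeCov_le_twoScale`**: the step fed by the fibre bound,
  `|Cov_K(F,H)| ≤ λ⁻¹ N (λ⁻¹ a_F)(λ⁻¹ a_H) r₁ r₂` with `r₁, r₂` bounding `|∇∂_j f₁|, |∇∂_j f₂|` on shell rows.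

NEAREST TREE ∕ MATHLIB ITEMS (dedup census; nothing restated).  USED BY NAME: module I `abs_cubeCov_le ∕ cubeCov_eq_sub ∕ merge* ∕
shellMean ∕ shellCov ∕ shellMass_pos`, module II `cubeCov_markov ∕ continuous_merge₂`, module III `hasDerivAt_shellMean`, module IV
(`cproj`, the `DependsOn` calculus, `condPot` and its three theorems), `BrascampLiebFibre.contDiff_one_fderiv_apply`-style
regularity is NOT assumed available for `∂_j fᵢ` — it is a hypothesis (`hg₁ ∕ hg₂`) of `abs_cubeCov_le_twoScale`.  SIBLINGS, not
duplicates: module III's `hasDerivAt_setIntegral_cube ∕ hasDerivAt_shellMean` differentiate in ONE shell coordinate (`HasDerivAt`);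
§D is the Fréchet ∕ `ContDiff ℝ 1` statement in the whole shell configuration, built from Mathlib's
`hasFDerivAt_integral_of_dominated_of_fderiv_le` + `continuous_parametric_integral_of_continuous` + `contDiff_one_iff_hasFDerivAt`
(Mathlib has no ready `ContDiff` parametric-integral lemma).  `T4CubePoincare.cubeVar_le_of_grad_le` (Brascamp–Lieb on the
window) enters only through module I.

CAVEATS ∕ NOT HERE.  (MODEL) as in modules I–IV: `ℝⁿ`, Lebesgue measure, cube window; Bałaban's chart transport is not here.
(RAW) `S > 0`, `λ > 0`; global `C¹ ∕ C²` hypotheses; the sup-bounds `β_j, γ_j` are hypotheses on the window `cube n S`.  NOT HERE: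
the scale recursion ∕ its certificate, any seed estimate (Combes–Thomas), any decay rate, any statement about Bałaban's
densities, balls instead of cubes, [B12] Theorem 2 or `B13TermWalkDataOneTorus.ExistsUniformAcrossSmall`.  Value = a kernel-checked
two-sided conditioning inequality on the cube model with structural hypotheses only, usable by name; NOT summit progress; no
YM-PLAN ∕ Track-B node is claimed closed.  NEW file, imports built tree modules only (modules I–IV); nothing modified;
dimension-generic; net new unproved facts: 0.
[cite: BrascampLieb1976, Thm 4.1; FriedliVelenik2017, Exercise 3.11 (3.26), Lemma 3.31, Lemma 6.3, Lemma 6.7 (6.7)–(6.10),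
§6.10.1 (6.110); GlimmJaffe1987, §4.3, Cor. 4.3.4; Durrett2019, Thm A.5.1, Thm A.5.3; Spivak1965, Thm 2-2, Thm 2-3, Thm 2-9] -/

set_option autoImplicit false

open MeasureTheory Set
open scoped Topology

namespace Literature.MathematicalPhysics.QuantumFieldTheory.Balaban1983to89.T4CubeShellDoubling

open Literature.MathematicalPhysics.QuantumFieldTheory.Balaban1983to89.T4CubePoincare
open Literature.MathematicalPhysics.QuantumFieldTheory.Balaban1983to89.T4CubeShellBlocks
open Literature.MathematicalPhysics.QuantumFieldTheory.Balaban1983to89.T4CubeShellTowerMarkov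
open Literature.MathematicalPhysics.QuantumFieldTheory.Balaban1983to89.T4CubeShellResponseStein
open Literature.MathematicalPhysics.QuantumFieldTheory.Balaban1983to89.T4CubeShellConditional
open Literature.Probability.Distributions

variable {n : ℕ}

/-! ## §B The gradient of the conditional mean, and THE DOUBLING STEP -/

section Doubling

/-- The conditional mean of the zero insert vanishes. [folklore] -/
private theorem shellMean_zero (lab : Fin n → Fin 3) (f : (Fin n → ℝ) → ℝ) (S : ℝ) (x : Fin n → ℝ) :
    shellMean lab f S (fun _ => (0 : ℝ)) x = 0 := by
  simp [shellMean]

/-- **Off the shell the conditional mean has zero gradient** (it is a function of the shell coordinates,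
`shellMean_dependsOn`; no regularity needed). [cite: Spivak1965, Thm 2-9; FriedliVelenik2017, Lemma 6.3] -/
theorem coordGradient_shellMean_of_ne (lab : Fin n → Fin 3) (f : (Fin n → ℝ) → ℝ) (S : ℝ)
    (F : (Fin n → ℝ) → ℝ) (x : Fin n → ℝ) {j : Fin n} (hj : lab j ≠ 1) :
    coordGradient (shellMean lab f S F) x j = 0 :=
  coordGradient_eq_zero_of_dependsOn (shellMean_dependsOn lab f S F) hj x

/-- **On a shell coordinate the gradient of the conditional mean is the response value** of
`hasDerivAt_shellMean`: `∂_j E[F|x_shell] = E[∂_j F|x_shell] − Cov(F, ∂_j f₁|x_shell)` (given Fréchet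
differentiability of the conditional mean at `x`, e.g. from §D).
[cite: GlimmJaffe1987, Cor. 4.3.4 (proof); FriedliVelenik2017, Lemma 3.31 (proof)] -/
theorem coordGradient_shellMean_shell {S : ℝ} (hS : 0 < S) (lab : Fin n → Fin 3)
    {f₁ F : (Fin n → ℝ) → ℝ} (hf₁ : ContDiff ℝ 1 f₁) (hF : ContDiff ℝ 1 F) {x : Fin n → ℝ}
    (hu : DifferentiableAt ℝ (shellMean lab f₁ S F) x) {j : Fin n} (hj : lab j = 1) :
    coordGradient (shellMean lab f₁ S F) x j
      = shellMean lab f₁ S (fun y => coordGradient F y j) x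
        - shellCov lab f₁ S F (fun y => coordGradient f₁ y j) x := by
  have h1 := hasDerivAt_shellMean hS lab hf₁ hF x hj
  have h2 : HasDerivAt (fun t : ℝ => shellMean lab f₁ S F (x + t • (Pi.single j 1 : Fin n → ℝ)))
      (fderiv ℝ (shellMean lab f₁ S F) x (Pi.single j 1)) 0 :=
    hu.hasFDerivAt.comp_hasDerivAt_of_eq (0 : ℝ) (hasDerivAt_line_single x j 0) (by simp)
  exact h2.unique h1

/-- The squared gradient of the one-sided conditional mean of an INSIDE insert `F` (blind to shell and outside)
is controlled by the shell family of half-distance conditional covariances: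
`|∇E[F|x_shell]|² ≤ Σ_{lab j = 1} β_j²` whenever `|Cov(F, ∂_j f₁ | x_shell)| ≤ β_j` on the shell.
[cite: GlimmJaffe1987, Cor. 4.3.4 (proof); FriedliVelenik2017, Lemma 3.31 (proof)] -/
theorem gradSq_shellMean_le {S : ℝ} (hS : 0 < S) (lab : Fin n → Fin 3) {f₁ F : (Fin n → ℝ) → ℝ}
    (hf₁ : ContDiff ℝ 1 f₁) (hF : ContDiff ℝ 1 F) (hFd : DependsOn F {i | lab i = 0}) {x : Fin n → ℝ}
    (hu : DifferentiableAt ℝ (shellMean lab f₁ S F) x) {β : Fin n → ℝ}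
    (hβ : ∀ j, lab j = 1 → |shellCov lab f₁ S F (fun y => coordGradient f₁ y j) x| ≤ β j) :
    coordGradient (shellMean lab f₁ S F) x ⬝ᵥ coordGradient (shellMean lab f₁ S F) x
      ≤ ∑ j ∈ Finset.univ.filter (fun j => lab j = 1), β j ^ 2 := by
  set u := coordGradient (shellMean lab f₁ S F) x with hu_def
  have hterm : ∀ j, u j * u j ≤ if lab j = 1 then β j ^ 2 else 0 := by
    intro j
    by_cases hj : lab j = 1
    · rw [if_pos hj]
      have hj0 : j ∉ {i | lab i = 0} := by
        intro h
        have h' : lab j = 0 := h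
        rw [h'] at hj
        exact absurd hj (by decide)
      have e : u j = -shellCov lab f₁ S F (fun y => coordGradient f₁ y j) x := by
        rw [hu_def, coordGradient_shellMean_shell hS lab hf₁ hF hu hj,
          coordGradient_dependsOn_of_not_mem hFd hj0, shellMean_zero, zero_sub]
      rw [e, neg_mul_neg, ← sq]
      have h := hβ j hj
      exact sq_le_sq.2 ((h.trans (le_abs_self _)))
    · rw [if_neg hj, hu_def, coordGradient_shellMean_of_ne lab f₁ S F x hj, mul_zero]
  calc u ⬝ᵥ u = ∑ j, u j * u j := rfl
    _ ≤ ∑ j, (if lab j = 1 then β j ^ 2 else 0) := Finset.sum_le_sum fun j _ => hterm j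
    _ = ∑ j ∈ Finset.univ.filter (fun j => lab j = 1), β j ^ 2 := (Finset.sum_filter _ _).symm

/-- **THE DOUBLING STEP (PROVED).**  Windowed Gibbs law `μ_K ∝ e^{-(f₁+f₂)} 1_K` on the cube `K = [-S,S]ⁿ`,
labels `0` inside ∕ `1` shell ∕ `2` outside; `f₁` blind to the outside block, `f₂` blind to the inside block
(finite range smaller than the shell thickness), `f₁ + f₂` `λ`-convex (`HessianBound`); inserts `F` (inside
only) and `H` (outside only), all `C¹ ∕ C²` as displayed.  If on the window the half-distance conditional
covariances are bounded coordinatewise on the shell, `|Cov(F, ∂_j f₁ | x_shell)| ≤ β_j`,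
`|Cov(H, ∂_j f₂ | x_shell)| ≤ γ_j`, and `Σ_shell β_j² ≤ a²`, `Σ_shell γ_j² ≤ b²`, then
`|Cov_K(F, H)| ≤ λ⁻¹ · a · b`.
Proof: `cubeCov_markov` (exact Markov reduction to the two one-sided conditional means), `abs_cubeCov_le`
(Brascamp–Lieb on the window for those means) and `gradSq_shellMean_le` (their gradients are the response
values, supported on the shell).  The two `ContDiff ℝ 1 (shellMean …)` binders are discharged by §D
(`contDiff_one_shellMean`); see `abs_cubeCov_le_doubling'`.
[cite: BrascampLieb1976, Thm 4.1; FriedliVelenik2017, Exercise 3.11 (3.26); GlimmJaffe1987, Cor. 4.3.4 (proof)] -/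
theorem abs_cubeCov_le_doubling {S lam : ℝ} (hS : 0 < S) (hlam : 0 < lam) (lab : Fin n → Fin 3)
    {f₁ f₂ F H : (Fin n → ℝ) → ℝ} (hf₁ : ContDiff ℝ 2 f₁) (hf₂ : ContDiff ℝ 2 f₂)
    (hB : HessianBound (f₁ + f₂) lam) (hF : ContDiff ℝ 1 F) (hH : ContDiff ℝ 1 H)
    (hf₁d : DependsOn f₁ {i | lab i ≠ 2}) (hFd : DependsOn F {i | lab i = 0})
    (hf₂d : DependsOn f₂ {i | lab i ≠ 0}) (hHd : DependsOn H {i | lab i = 2})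
    (hu : ContDiff ℝ 1 (shellMean lab f₁ S F)) (hv : ContDiff ℝ 1 (shellMean lab f₂ S H))
    {β γ : Fin n → ℝ} {a b : ℝ} (ha : 0 < a) (hb : 0 < b)
    (hβ : ∀ x ∈ cube n S, ∀ j, lab j = 1 → |shellCov lab f₁ S F (fun y => coordGradient f₁ y j) x| ≤ β j)
    (hγ : ∀ x ∈ cube n S, ∀ j, lab j = 1 → |shellCov lab f₂ S H (fun y => coordGradient f₂ y j) x| ≤ γ j)
    (hβa : ∑ j ∈ Finset.univ.filter (fun j => lab j = 1), β j ^ 2 ≤ a ^ 2)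
    (hγb : ∑ j ∈ Finset.univ.filter (fun j => lab j = 1), γ j ^ 2 ≤ b ^ 2) :
    |cubeCov (f₁ + f₂) S F H| ≤ lam⁻¹ * a * b := by
  have hFd' : DependsOn F {i | lab i ≠ 2} :=
    hFd.mono fun i hi => by
      have hi' : lab i = 0 := hi
      show lab i ≠ 2
      rw [hi']; decide
  have hHd' : DependsOn H {i | lab i ≠ 0} :=
    hHd.mono fun i hi => by
      have hi' : lab i = 2 := hi
      show lab i ≠ 0
      rw [hi']; decide
  -- the outside labelling read from the other side: `lab' = 2 - lab` swaps inside and outside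
  set lab' : Fin n → Fin 3 := fun i => if lab i = 0 then 2 else if lab i = 2 then 0 else 1 with hlab'
  have hHd0 : DependsOn H {i | lab' i = 0} :=
    hHd.mono fun i hi => by
      have hi' : lab i = 2 := hi
      show lab' i = 0
      simp only [hlab', hi']
      decide
  have hshell : ∀ i, lab' i = 1 ↔ lab i = 1 := by
    intro i
    simp only [hlab']
    constructor
    · intro h
      by_cases h0 : lab i = 0
      · simp [h0] at h
      · by_cases h2 : lab i = 2
        · simp [h2] at h
        · -- `lab i ∉ {0, 2}` in `Fin 3`
          have : ∀ c : Fin 3, c ≠ 0 → c ≠ 2 → c = 1 := by decide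
          exact this _ h0 h2
    · intro h
      simp [h]
  -- the conditional means for `lab'` coincide with those for `lab` (merge reads only `lab = 1`)
  have hmerge : ∀ x z : Fin n → ℝ, merge lab' x z = merge lab x z := by
    intro x z
    funext i
    by_cases hi : lab i = 1
    · rw [merge_apply_shell hi, merge_apply_shell ((hshell i).2 hi)]
    · have hi' : lab' i ≠ 1 := fun h => hi ((hshell i).1 h)
      rw [merge_apply_of_ne hi, merge_apply_of_ne hi']
  have hsm : ∀ (f G : (Fin n → ℝ) → ℝ), shellMean lab' f S G = shellMean lab f S G := by
    intro f G
    funext x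
    simp only [shellMean, shellMass, hmerge]
  have hsc : ∀ (f G G' : (Fin n → ℝ) → ℝ), shellCov lab' f S G G' = shellCov lab f S G G' := by
    intro f G G'
    funext x
    simp only [shellCov, hsm]
  rw [cubeCov_markov hS lab hf₁.continuous hf₂.continuous hF.continuous hH.continuous hf₁d hFd' hf₂d hHd']
  refine abs_cubeCov_le hS hlam (hf₁.add hf₂) hB hu hv ha hb ?_ ?_
  · intro x hx
    exact (gradSq_shellMean_le hS lab (hf₁.of_le (by norm_num)) hF hFd (hu.differentiable one_ne_zero x)
      (hβ x hx)).trans hβa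
  · intro x hx
    have hv' : DifferentiableAt ℝ (shellMean lab' f₂ S H) x := by
      rw [hsm]; exact hv.differentiable one_ne_zero x
    have key := gradSq_shellMean_le hS lab' (hf₂.of_le (by norm_num)) hH hHd0 hv'
      (β := γ) (fun j hj => by rw [hsc]; exact hγ x hx j ((hshell j).1 hj))
    rw [hsm] at key
    have hfilter : Finset.univ.filter (fun j => lab' j = 1) = Finset.univ.filter (fun j => lab j = 1) := by
      ext j; simp [hshell j]
    rw [hfilter] at key
    exact key.trans hγb

end Doubling

/-! ## §D Differentiation under the windowed integral: the conditional mean is `C¹` in the shell configuration -/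

section Regularity

/-- `x ↦ Φ(merge lab x z)` has Fréchet derivative `DΦ(merge lab x z) ∘ Q`, `Q = cproj {lab = 1}` (the shell
coordinates enter `merge` affinely: `merge_eq_affine_left`).
[cite: Spivak1965, Thm 2-2 (chain rule), Thm 2-3 (1)–(2); FriedliVelenik2017, Lemma 6.7 (6.7)–(6.10)] -/
theorem hasFDerivAt_apply_merge_left (lab : Fin n → Fin 3) {Φ : (Fin n → ℝ) → ℝ} (hΦ : Differentiable ℝ Φ)
    (z x : Fin n → ℝ) :
    HasFDerivAt (fun x' => Φ (merge lab x' z)) ((fderiv ℝ Φ (merge lab x z)).comp (cproj {i | lab i = 1})) x := by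
  have hfun : (fun x' => Φ (merge lab x' z)) = fun x' => Φ (merge lab 0 z + cproj {i | lab i = 1} x') := by
    funext x'
    rw [merge_eq_affine_left lab x' z]
  rw [hfun]
  have hpt : merge lab 0 z + cproj {i | lab i = 1} x = merge lab x z := (merge_eq_affine_left lab x z).symm
  have h := hasFDerivAt_comp_affine (G := ℝ) (merge lab 0 z) (cproj {i | lab i = 1}) (z := x)
    (by rw [hpt]; exact hΦ _)
  rw [hpt] at h
  exact h

/-- The derivative field `(x, z) ↦ DΦ(merge lab x z) ∘ Q` is jointly continuous for `Φ ∈ C¹`.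
[cite: Spivak1965, Thm 2-2 (chain rule), Thm 2-3 (1)–(2); FriedliVelenik2017, Lemma 6.7 (6.7)–(6.10)] -/
theorem continuous_fderiv_merge_comp (lab : Fin n → Fin 3) {Φ : (Fin n → ℝ) → ℝ} (hΦ : ContDiff ℝ 1 Φ) :
    Continuous fun p : (Fin n → ℝ) × (Fin n → ℝ) =>
      (fderiv ℝ Φ (merge lab p.1 p.2)).comp (cproj {i | lab i = 1}) :=
  ((hΦ.continuous_fderiv one_ne_zero).comp (continuous_merge₂ lab)).clm_comp continuous_const

/-- **DIFFERENTIATION UNDER `∫_K dz` IN THE SHELL CONFIGURATION (PROVED).**  For `Φ ∈ C¹`,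
`x ↦ ∫_K Φ(merge lab x z) dz` has Fréchet derivative `∫_K DΦ(merge lab x z) ∘ Q dz`
(`hasFDerivAt_integral_of_dominated_of_fderiv_le`, dominating constant from compactness of `B̄(x₀,1) × K`).
[cite: Durrett2019, Thm A.5.1, Thm A.5.3] -/
theorem hasFDerivAt_setIntegral_merge (lab : Fin n → Fin 3) {Φ : (Fin n → ℝ) → ℝ} (hΦ : ContDiff ℝ 1 Φ)
    (S : ℝ) (x₀ : Fin n → ℝ) :
    HasFDerivAt (fun x => ∫ z in cube n S, Φ (merge lab x z))
      (∫ z in cube n S, (fderiv ℝ Φ (merge lab x₀ z)).comp (cproj {i | lab i = 1})) x₀ := by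
  have hK : IsCompact (cube n S) := isCompact_cube n S
  haveI : IsFiniteMeasure (volume.restrict (cube n S)) := isFiniteMeasure_restrict.2 hK.measure_lt_top.ne
  have hΦd : Differentiable ℝ Φ := hΦ.differentiable one_ne_zero
  have hΦc : Continuous Φ := hΦ.continuous
  have hF'c := continuous_fderiv_merge_comp lab hΦ
  have hI : IsCompact (Metric.closedBall x₀ 1 ×ˢ cube n S) := (isCompact_closedBall x₀ 1).prod hK
  obtain ⟨C, hC⟩ := hI.exists_bound_of_continuousOn hF'c.continuousOn
  have hs : Metric.closedBall x₀ 1 ∈ 𝓝 x₀ := Metric.closedBall_mem_nhds x₀ one_pos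
  refine hasFDerivAt_integral_of_dominated_of_fderiv_le (μ := volume.restrict (cube n S))
    (F := fun x z => Φ (merge lab x z))
    (F' := fun x z => (fderiv ℝ Φ (merge lab x z)).comp (cproj {i | lab i = 1})) (bound := fun _ => C) hs
    ?_ ?_ ?_ ?_ ?_ ?_
  · exact Filter.Eventually.of_forall fun x => (hΦc.comp (continuous_merge_right lab x)).aestronglyMeasurable
  · exact integrableOn_cube' (hΦc.comp (continuous_merge_right lab x₀)) S
  · exact (hF'c.comp (continuous_const.prodMk continuous_id)).aestronglyMeasurable
  · rw [ae_restrict_iff' (measurableSet_cube' n S)]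
    exact Filter.Eventually.of_forall fun z hz x hx => hC (x, z) (Set.mk_mem_prod hx hz)
  · exact integrable_const C
  · exact Filter.Eventually.of_forall fun z x _ => hasFDerivAt_apply_merge_left lab hΦd z x

/-- `x ↦ ∫_K Φ(merge lab x z) dz` is `C¹` for `Φ ∈ C¹` (derivative `∫_K DΦ ∘ Q`, continuous by
`continuous_parametric_integral_of_continuous`). [cite: Durrett2019, Thm A.5.1, Thm A.5.3] -/
theorem contDiff_one_setIntegral_merge (lab : Fin n → Fin 3) {Φ : (Fin n → ℝ) → ℝ} (hΦ : ContDiff ℝ 1 Φ)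
    (S : ℝ) : ContDiff ℝ 1 (fun x => ∫ z in cube n S, Φ (merge lab x z)) := by
  rw [contDiff_one_iff_hasFDerivAt]
  refine ⟨fun x => ∫ z in cube n S, (fderiv ℝ Φ (merge lab x z)).comp (cproj {i | lab i = 1}), ?_,
    fun x => hasFDerivAt_setIntegral_merge lab hΦ S x⟩
  exact continuous_parametric_integral_of_continuous
    (f := fun x z => (fderiv ℝ Φ (merge lab x z)).comp (cproj {i | lab i = 1}))
    (continuous_fderiv_merge_comp lab hΦ) (isCompact_cube n S)

/-- **The conditional mean `x ↦ E_{μ_K}[F | x_shell]` is `C¹` (PROVED)** for `f, F ∈ C¹`,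
`S > 0` (numerator and mass by `contDiff_one_setIntegral_merge`, quotient by `shellMass_pos`).
[cite: Durrett2019, Thm A.5.1, Thm A.5.3; FriedliVelenik2017, §6.10.1 (6.110)] -/
theorem contDiff_one_shellMean (lab : Fin n → Fin 3) {f F : (Fin n → ℝ) → ℝ} (hf : ContDiff ℝ 1 f)
    (hF : ContDiff ℝ 1 F) {S : ℝ} (hS : 0 < S) : ContDiff ℝ 1 (shellMean lab f S F) := by
  have hE : ContDiff ℝ 1 fun y => Real.exp (-f y) := hf.neg.exp
  have hN : ContDiff ℝ 1 (fun x => ∫ z in cube n S, F (merge lab x z) * Real.exp (-f (merge lab x z))) :=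
    contDiff_one_setIntegral_merge lab (Φ := fun y => F y * Real.exp (-f y)) (hF.mul hE) S
  have hZ : ContDiff ℝ 1 (fun x => ∫ z in cube n S, Real.exp (-f (merge lab x z))) :=
    contDiff_one_setIntegral_merge lab (Φ := fun y => Real.exp (-f y)) hE S
  exact hN.div hZ fun x => (shellMass_pos lab hf.continuous hS x).ne'

/-- The conditional covariance `x ↦ Cov(F, G | x_shell)` is `C¹` (hence continuous) for `f, F, G ∈ C¹`.
[cite: Durrett2019, Thm A.5.1, Thm A.5.3; FriedliVelenik2017, §6.10.1 (6.110)] -/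
theorem contDiff_one_shellCov (lab : Fin n → Fin 3) {f F G : (Fin n → ℝ) → ℝ} (hf : ContDiff ℝ 1 f)
    (hF : ContDiff ℝ 1 F) (hG : ContDiff ℝ 1 G) {S : ℝ} (hS : 0 < S) : ContDiff ℝ 1 (shellCov lab f S F G) :=
  ((contDiff_one_shellMean lab hf (hF.mul hG) hS).sub
    ((contDiff_one_shellMean lab hf hF hS).mul (contDiff_one_shellMean lab hf hG hS)) : _)

/-- **THE DOUBLING STEP, regularity binders discharged.**  `abs_cubeCov_le_doubling` with the `C¹`-regularity of
the two conditional means supplied by `contDiff_one_shellMean` (`f₁, f₂ ∈ C²`, `F, H ∈ C¹`, `S > 0`):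
`|Cov_K(F, H)| ≤ λ⁻¹ · a · b` whenever the shell-indexed conditional covariances are bounded by `β`, `γ` with
`Σ_shell β_j² ≤ a²`, `Σ_shell γ_j² ≤ b²`.
[cite: BrascampLieb1976, Thm 4.1; FriedliVelenik2017, Exercise 3.11 (3.26); GlimmJaffe1987, Cor. 4.3.4 (proof)] -/
theorem abs_cubeCov_le_doubling' {S lam : ℝ} (hS : 0 < S) (hlam : 0 < lam) (lab : Fin n → Fin 3)
    {f₁ f₂ F H : (Fin n → ℝ) → ℝ} (hf₁ : ContDiff ℝ 2 f₁) (hf₂ : ContDiff ℝ 2 f₂)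
    (hB : HessianBound (f₁ + f₂) lam) (hF : ContDiff ℝ 1 F) (hH : ContDiff ℝ 1 H)
    (hf₁d : DependsOn f₁ {i | lab i ≠ 2}) (hFd : DependsOn F {i | lab i = 0})
    (hf₂d : DependsOn f₂ {i | lab i ≠ 0}) (hHd : DependsOn H {i | lab i = 2})
    {β γ : Fin n → ℝ} {a b : ℝ} (ha : 0 < a) (hb : 0 < b)
    (hβ : ∀ x ∈ cube n S, ∀ j, lab j = 1 → |shellCov lab f₁ S F (fun y => coordGradient f₁ y j) x| ≤ β j)
    (hγ : ∀ x ∈ cube n S, ∀ j, lab j = 1 → |shellCov lab f₂ S H (fun y => coordGradient f₂ y j) x| ≤ γ j)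
    (hβa : ∑ j ∈ Finset.univ.filter (fun j => lab j = 1), β j ^ 2 ≤ a ^ 2)
    (hγb : ∑ j ∈ Finset.univ.filter (fun j => lab j = 1), γ j ^ 2 ≤ b ^ 2) :
    |cubeCov (f₁ + f₂) S F H| ≤ lam⁻¹ * a * b :=
  abs_cubeCov_le_doubling hS hlam lab hf₁ hf₂ hB hF hH hf₁d hFd hf₂d hHd
    (contDiff_one_shellMean lab (hf₁.of_le (by norm_num)) hF hS)
    (contDiff_one_shellMean lab (hf₂.of_le (by norm_num)) hH hS) ha hb hβ hγ hβa hγb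

end Regularity

/-! ## §E The step in PROFILE form (the hypothesis shape of a quadratic scale recursion) -/

section Profile

/-- THE STEP with NON-STRICT constants `0 ≤ a`, `0 ≤ b` (limit `ε ↓ 0` in `abs_cubeCov_le_doubling'`).
[cite: BrascampLieb1976, Thm 4.1; FriedliVelenik2017, Exercise 3.11 (3.26); GlimmJaffe1987, Cor. 4.3.4 (proof)] -/
theorem abs_cubeCov_le_doubling₀ {S lam : ℝ} (hS : 0 < S) (hlam : 0 < lam) (lab : Fin n → Fin 3)
    {f₁ f₂ F H : (Fin n → ℝ) → ℝ} (hf₁ : ContDiff ℝ 2 f₁) (hf₂ : ContDiff ℝ 2 f₂)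
    (hB : HessianBound (f₁ + f₂) lam) (hF : ContDiff ℝ 1 F) (hH : ContDiff ℝ 1 H)
    (hf₁d : DependsOn f₁ {i | lab i ≠ 2}) (hFd : DependsOn F {i | lab i = 0})
    (hf₂d : DependsOn f₂ {i | lab i ≠ 0}) (hHd : DependsOn H {i | lab i = 2})
    {β γ : Fin n → ℝ} {a b : ℝ} (ha : 0 ≤ a) (hb : 0 ≤ b)
    (hβ : ∀ x ∈ cube n S, ∀ j, lab j = 1 → |shellCov lab f₁ S F (fun y => coordGradient f₁ y j) x| ≤ β j)
    (hγ : ∀ x ∈ cube n S, ∀ j, lab j = 1 → |shellCov lab f₂ S H (fun y => coordGradient f₂ y j) x| ≤ γ j)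
    (hβa : ∑ j ∈ Finset.univ.filter (fun j => lab j = 1), β j ^ 2 ≤ a ^ 2)
    (hγb : ∑ j ∈ Finset.univ.filter (fun j => lab j = 1), γ j ^ 2 ≤ b ^ 2) :
    |cubeCov (f₁ + f₂) S F H| ≤ lam⁻¹ * a * b := by
  have h : ∀ ε : ℝ, 0 < ε → |cubeCov (f₁ + f₂) S F H| ≤ lam⁻¹ * (a + ε) * (b + ε) := by
    intro ε hε
    refine abs_cubeCov_le_doubling' hS hlam lab hf₁ hf₂ hB hF hH hf₁d hFd hf₂d hHd (by linarith) (by linarith)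
      hβ hγ (hβa.trans (by nlinarith)) (hγb.trans (by nlinarith))
  have hc : Continuous fun ε : ℝ => lam⁻¹ * (a + ε) * (b + ε) := by fun_prop
  have hg : Filter.Tendsto (fun ε : ℝ => lam⁻¹ * (a + ε) * (b + ε)) (𝓝[>] 0)
      (𝓝 (lam⁻¹ * (a + 0) * (b + 0))) :=
    (hc.tendsto 0).mono_left nhdsWithin_le_nhds
  rw [add_zero, add_zero] at hg
  exact ge_of_tendsto hg (eventually_nhdsWithin_of_forall fun ε hε => h ε hε)

/-- **THE STEP IN PROFILE FORM (the hypothesis shape of a quadratic scale recursion `κ(2m) ≤ c·κ(m)²`):**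
if every shell-indexed conditional covariance at HALF the distance is bounded by `C_F·κ₁` (resp. `C_H·κ₂`), then
`|Cov_K(F, H)| ≤ λ⁻¹ · N · C_F C_H · κ₁ κ₂`, `N = #shell`.  With `κ₁ = κ₂ = κ(m)` this is `κ(2m + shell) ≤ c·κ(m)²`,
`c = λ⁻¹ N C_F C_H` (in lattice applications `N ~ m^{d-1}` is a polynomial prefactor).
[cite: BrascampLieb1976, Thm 4.1; FriedliVelenik2017, Exercise 3.11 (3.26); GlimmJaffe1987, Cor. 4.3.4 (proof)] -/
theorem abs_cubeCov_le_doubling_profile {S lam : ℝ} (hS : 0 < S) (hlam : 0 < lam) (lab : Fin n → Fin 3)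
    {f₁ f₂ F H : (Fin n → ℝ) → ℝ} (hf₁ : ContDiff ℝ 2 f₁) (hf₂ : ContDiff ℝ 2 f₂)
    (hB : HessianBound (f₁ + f₂) lam) (hF : ContDiff ℝ 1 F) (hH : ContDiff ℝ 1 H)
    (hf₁d : DependsOn f₁ {i | lab i ≠ 2}) (hFd : DependsOn F {i | lab i = 0})
    (hf₂d : DependsOn f₂ {i | lab i ≠ 0}) (hHd : DependsOn H {i | lab i = 2})
    {κ₁ κ₂ C_F C_H : ℝ} (hκ₁ : 0 ≤ κ₁) (hκ₂ : 0 ≤ κ₂) (hCF : 0 ≤ C_F) (hCH : 0 ≤ C_H)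
    (hβ : ∀ x ∈ cube n S, ∀ j, lab j = 1 → |shellCov lab f₁ S F (fun y => coordGradient f₁ y j) x| ≤ C_F * κ₁)
    (hγ : ∀ x ∈ cube n S, ∀ j, lab j = 1 → |shellCov lab f₂ S H (fun y => coordGradient f₂ y j) x| ≤ C_H * κ₂) :
    |cubeCov (f₁ + f₂) S F H|
      ≤ lam⁻¹ * (Finset.univ.filter (fun j => lab j = 1)).card * (C_F * C_H) * (κ₁ * κ₂) := by
  set N : ℕ := (Finset.univ.filter (fun j => lab j = 1)).card with hN
  have hsN : Real.sqrt N * Real.sqrt N = N := Real.mul_self_sqrt (Nat.cast_nonneg N)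
  have key := abs_cubeCov_le_doubling₀ hS hlam lab hf₁ hf₂ hB hF hH hf₁d hFd hf₂d hHd
    (β := fun _ => C_F * κ₁) (γ := fun _ => C_H * κ₂)
    (a := Real.sqrt N * (C_F * κ₁)) (b := Real.sqrt N * (C_H * κ₂)) (by positivity) (by positivity) hβ hγ
    (by
      rw [Finset.sum_const, nsmul_eq_mul, ← hN,
        show (Real.sqrt N * (C_F * κ₁)) ^ 2 = Real.sqrt N * Real.sqrt N * (C_F * κ₁) ^ 2 by ring, hsN])
    (by
      rw [Finset.sum_const, nsmul_eq_mul, ← hN,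
        show (Real.sqrt N * (C_H * κ₂)) ^ 2 = Real.sqrt N * Real.sqrt N * (C_H * κ₂) ^ 2 by ring, hsN])
  rw [show lam⁻¹ * (Real.sqrt N * (C_F * κ₁)) * (Real.sqrt N * (C_H * κ₂))
      = lam⁻¹ * (Real.sqrt N * Real.sqrt N) * (C_F * C_H) * (κ₁ * κ₂) by ring, hsN] at key
  exact key

end Profile

/-! ## §F Brascamp–Lieb on the fibre: the conditional covariance given the shell; the two-scale bound -/

section Seed

/-- **THE BOTTOM OF THE TOWER (PROVED): Brascamp–Lieb ON THE FIBRE.**  For `f₁ + f₂` with `HessianBound · λ`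
(`f₁` outside-blind, `f₂` inside-blind, both `C²`) and inserts `F, G ∈ C¹` blind to the outside block with
`|∇F| ≤ a`, `|∇G| ≤ b`: every conditional covariance obeys `|Cov(F, G | x_shell)| ≤ λ⁻¹ a b` — the class is
closed under conditioning (`shellCov_eq_cubeCov_condPot`, `hessianBound_condPot`) and (D1) applies on the fibre.
[cite: BrascampLieb1976, Thm 4.1; FriedliVelenik2017, Lemma 6.7 (6.7); Durrett2019, Thm 2.1.12] -/
theorem abs_shellCov_le {S lam : ℝ} (hS : 0 < S) (hlam : 0 < lam) (lab : Fin n → Fin 3)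
    {f₁ f₂ F G : (Fin n → ℝ) → ℝ} (hf₁ : ContDiff ℝ 2 f₁) (hf₂ : ContDiff ℝ 2 f₂)
    (hB : HessianBound (f₁ + f₂) lam) (hf₁d : DependsOn f₁ {i | lab i ≠ 2}) (hf₂d : DependsOn f₂ {i | lab i ≠ 0})
    (hF : ContDiff ℝ 1 F) (hG : ContDiff ℝ 1 G) (hFd : DependsOn F {i | lab i ≠ 2}) (hGd : DependsOn G {i | lab i ≠ 2})
    {a b : ℝ} (ha : 0 < a) (hb : 0 < b)
    (hFa : ∀ y, coordGradient F y ⬝ᵥ coordGradient F y ≤ a ^ 2)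
    (hGb : ∀ y, coordGradient G y ⬝ᵥ coordGradient G y ≤ b ^ 2) (x : Fin n → ℝ) :
    |shellCov lab f₁ S F G x| ≤ lam⁻¹ * a * b := by
  rw [shellCov_eq_cubeCov_condPot hS lab lam hf₁.continuous hF.continuous hG.continuous hf₁d hFd hGd x]
  have hm : ContDiff ℝ 1 (merge lab x) := contDiff_merge_right lab x
  have hF' : ContDiff ℝ 1 (fun z => F (merge lab x z)) := hF.comp hm
  have hG' : ContDiff ℝ 1 (fun z => G (merge lab x z)) := hG.comp hm
  exact abs_cubeCov_le hS hlam (contDiff_condPot lab lam hf₁ x) (hessianBound_condPot lab hf₁ hf₂ hB hf₁d hf₂d x)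
    hF' hG' ha hb
    (fun z _ => (gradSq_comp_merge_le lab (hF.differentiable one_ne_zero) x z).trans (hFa _))
    (fun z _ => (gradSq_comp_merge_le lab (hG.differentiable one_ne_zero) x z).trans (hGb _))

/-- **TWO SCALES (PROVED): STEP ∘ BOTTOM.**  With `|∇F| ≤ a_F`, `|∇H| ≤ a_H` and the Hessian-row bounds
`|∇∂_j f₁| ≤ r₁`, `|∇∂_j f₂| ≤ r₂` for the shell coordinates `j` (the partials `∂_j fᵢ` assumed `C¹`, e.g.
`fᵢ ∈ C³`), the doubling step fed by Brascamp–Lieb on the two fibres gives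
`|Cov_K(F, H)| ≤ λ⁻¹ N · (λ⁻¹ a_F)(λ⁻¹ a_H) · r₁ r₂` — versus the one-scale `λ⁻¹ a_F a_H`: the gain factor
`λ⁻² N r₁ r₂` is the quantity the scale recursion squares at every doubling.
[cite: BrascampLieb1976, Thm 4.1; FriedliVelenik2017, Exercise 3.11 (3.26); GlimmJaffe1987, Cor. 4.3.4 (proof)] -/
theorem abs_cubeCov_le_twoScale {S lam : ℝ} (hS : 0 < S) (hlam : 0 < lam) (lab : Fin n → Fin 3)
    {f₁ f₂ F H : (Fin n → ℝ) → ℝ} (hf₁ : ContDiff ℝ 2 f₁) (hf₂ : ContDiff ℝ 2 f₂)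
    (hB : HessianBound (f₁ + f₂) lam) (hF : ContDiff ℝ 1 F) (hH : ContDiff ℝ 1 H)
    (hf₁d : DependsOn f₁ {i | lab i ≠ 2}) (hFd : DependsOn F {i | lab i = 0})
    (hf₂d : DependsOn f₂ {i | lab i ≠ 0}) (hHd : DependsOn H {i | lab i = 2})
    (hg₁ : ∀ j, lab j = 1 → ContDiff ℝ 1 (fun y => coordGradient f₁ y j))
    (hg₂ : ∀ j, lab j = 1 → ContDiff ℝ 1 (fun y => coordGradient f₂ y j))
    {a_F a_H r₁ r₂ : ℝ} (haF : 0 < a_F) (haH : 0 < a_H) (hr₁ : 0 < r₁) (hr₂ : 0 < r₂)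
    (hFa : ∀ y, coordGradient F y ⬝ᵥ coordGradient F y ≤ a_F ^ 2)
    (hHa : ∀ y, coordGradient H y ⬝ᵥ coordGradient H y ≤ a_H ^ 2)
    (hR₁ : ∀ j, lab j = 1 → ∀ y, coordGradient (fun y => coordGradient f₁ y j) y
      ⬝ᵥ coordGradient (fun y => coordGradient f₁ y j) y ≤ r₁ ^ 2)
    (hR₂ : ∀ j, lab j = 1 → ∀ y, coordGradient (fun y => coordGradient f₂ y j) y
      ⬝ᵥ coordGradient (fun y => coordGradient f₂ y j) y ≤ r₂ ^ 2) :
    |cubeCov (f₁ + f₂) S F H|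
      ≤ lam⁻¹ * (Finset.univ.filter (fun j => lab j = 1)).card * (lam⁻¹ * a_F * (lam⁻¹ * a_H)) * (r₁ * r₂) := by
  have hFd' : DependsOn F {i | lab i ≠ 2} := hFd.mono fun i hi => by
    have hi' : lab i = 0 := hi
    show lab i ≠ 2
    rw [hi']; decide
  have hHd' : DependsOn H {i | lab i ≠ 0} := hHd.mono fun i hi => by
    have hi' : lab i = 2 := hi
    show lab i ≠ 0
    rw [hi']; decide
  -- the H-side is the F-side for the swapped labelling
  set lab' : Fin n → Fin 3 := fun i => if lab i = 0 then 2 else if lab i = 2 then 0 else 1 with hlab'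
  have hswap : ∀ i, (lab' i ≠ 2 ↔ lab i ≠ 0) ∧ (lab' i ≠ 0 ↔ lab i ≠ 2) ∧ (lab' i = 1 ↔ lab i = 1) := by
    intro i
    simp only [hlab']
    have key : ∀ c : Fin 3, ((if c = 0 then (2 : Fin 3) else if c = 2 then 0 else 1) ≠ 2 ↔ c ≠ 0) ∧
        ((if c = 0 then (2 : Fin 3) else if c = 2 then 0 else 1) ≠ 0 ↔ c ≠ 2) ∧
        ((if c = 0 then (2 : Fin 3) else if c = 2 then 0 else 1) = 1 ↔ c = 1) := by decide
    exact key (lab i)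
  have hshell : ∀ x z, merge lab' x z = merge lab x z := by
    intro x z; funext i
    by_cases h1 : lab i = 1
    · rw [merge_apply_shell h1, merge_apply_shell ((hswap i).2.2.2 h1)]
    · rw [merge_apply_of_ne h1, merge_apply_of_ne (fun h => h1 ((hswap i).2.2.1 h))]
  have hsm : ∀ (g Φ : (Fin n → ℝ) → ℝ) x, shellMean lab' g S Φ x = shellMean lab g S Φ x := by
    intro g Φ x
    simp only [shellMean, shellMass, hshell]
  have hsc : ∀ (g Φ Ψ : (Fin n → ℝ) → ℝ) x, shellCov lab' g S Φ Ψ x = shellCov lab g S Φ Ψ x := by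
    intro g Φ Ψ x
    simp only [shellCov, hsm]
  have hf₂d' : DependsOn f₂ {i | lab' i ≠ 2} := fun y y' h => hf₂d fun i hi => h i ((hswap i).1.2 hi)
  have hf₁d' : DependsOn f₁ {i | lab' i ≠ 0} := fun y y' h => hf₁d fun i hi => h i ((hswap i).2.1.2 hi)
  have hHd'' : DependsOn H {i | lab' i ≠ 2} := fun y y' h => hHd' fun i hi => h i ((hswap i).1.2 hi)
  have hB' : HessianBound (f₂ + f₁) lam := by rwa [add_comm]
  refine abs_cubeCov_le_doubling_profile hS hlam lab hf₁ hf₂ hB hF hH hf₁d hFd hf₂d hHd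
    (C_F := lam⁻¹ * a_F) (κ₁ := r₁) (C_H := lam⁻¹ * a_H) (κ₂ := r₂) hr₁.le hr₂.le (by positivity)
    (by positivity) ?_ ?_
  · intro x _ j hj
    exact abs_shellCov_le hS hlam lab hf₁ hf₂ hB hf₁d hf₂d hF (hg₁ j hj) hFd'
      (dependsOn_coordGradient hf₁d (hf₁.of_le (by norm_num)) j) haF hr₁ hFa (hR₁ j hj) x
  · intro x _ j hj
    rw [← hsc]
    exact abs_shellCov_le hS hlam lab' hf₂ hf₁ hB' hf₂d' hf₁d' hH (hg₂ j hj) hHd''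
      (dependsOn_coordGradient hf₂d' (hf₂.of_le (by norm_num)) j) haH hr₂ hHa (hR₂ j hj) x

end Seed

end Literature.MathematicalPhysics.QuantumFieldTheory.Balaban1983to89.T4CubeShellDoubling
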